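import Summits.Ventures.YMGap.Thresholds.ZeroCouplingKernelAllGroups
import HarnessLib

/-!
# The ONE-PLAQUETTE LAW, part 1 of 2: the termwise kernel estimate (row type C-SLOPE-0-G, part 4a)

Cell `pub-ymgap`, seat ds-1 (gen 15). HONEST FRAMING: exact LATTICE statements at the strong-coupling end point `β = 0` of the Wilson
action `β Σ_p (N − Re tr ρ(U_p))` on `ℤ^d`, for an ARBITRARY compact metrisable gauge group `G`, continuous `ρ`, every `d`, both signs of
`β`; tools for `ZeroCouplingOnePlaquetteLaw` (part 4b): in every DLR state of every compact gauge group a single-plaquette observable equals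
its ONE-PLAQUETTE tilted Haar mean `⟨φ⟩₁(β) = ∫ φ e^{−β(N − Re tr ρ)} dHaar / ∫ e^{−β(N − Re tr ρ)} dHaar` up to `O(β⁴)`, uniformly over all
DLR states. Generality/exactness, not a threshold; nothing about weak coupling, the continuum, or Clay. Kernel theorems, 0 defs, 0 compute.

## Mechanism and contents

DLR at the four links `Λ` of `p` gives `Φ_η(β) = E_η[φ(U_p) e^{−β S_Λ}] / E_η[e^{−β S_Λ}]` (`E_η` = product Haar on `Λ` glued with `η`).
Split `S_Λ = s(U_p) + Σ_{q ≠ p} s_q` over the neighbouring plaquettes and expand `e^{−β Σ_q s_q} = Π_q (1 + h_q) = Σ_S Π_{q∈S} h_q`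
(`h_q = e^{−β s_q} − 1 = O(β)`). ★ `integral_comp_holonomy_mul_pi_glueWith_of_update`: a continuous factor that ignores a link of `p`
decouples from `U_p`, which is then Haar distributed (gen 11's resampling `integral_comp_plaquette_mul_eq`). ★ `abs_term_sub_term_le`:
a set `S` of at most three neighbours leaves a link of `p` untouched (gen 11's `exists_mem_plaquetteEdges_forall_not_mem` — two distinct
plaquettes share at most one link), so its numerator and denominator terms reproduce `⟨φ⟩₁(β)` EXACTLY; every term with `|S| ≥ 4` is
`O(t^{|S|})`, `t = e^{|β|(N+M)} − 1 = O(β)`; in all cases `|z·E_η[φ e^{−βs}(U_p) Ψ_S] − a·E_η[e^{−βs}(U_p) Ψ_S]| ≤ 2 C z e^{|β|b} t⁴(1+t)ⁿ`.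
Elementary real lemmas: the ratio estimate `abs_div_sub_div_le_of_abs_sub_le`, and the
`|β| ≤ 1` book-keeping `kernelBound_le_of_abs_le_one`.

References (mechanism): R. Balian, J.-M. Drouffe, C. Itzykson, PRD 11 (1975) 2104 §III (strong-coupling series; one-plaquette integrals);
H.-O. Georgii, *Gibbs Measures and Phase Transitions* (2011) Rem. 1.24 (DLR); K. Osterwalder, E. Seiler, Ann. Phys. 110 (1978) 440 §3.
-/

noncomputable section

open MeasureTheory ProbabilityTheory Set Filter Topology Finset
open scoped NNReal
open Literature.Probability.LatticeModels (glueWith measurable_glueWith glueWith_apply_mem glueWith_apply_not_mem)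
open Literature.MathematicalPhysics.QuantumLattice (LGConfig ZdEdge ZdPlaquette plaquetteObs plaquetteEdges plaquettesTouching
  plaquetteHolonomyZd wilsonBoundaryAction IsCylinder continuous_plaquetteObs isCylinder_plaquetteObs continuous_wilsonBoundaryAction
  integrable_of_bound exists_bound_of_continuous)
open Literature.MathematicalPhysics.QuantumFieldTheory hiding ZdEdge
open Literature.MathematicalPhysics.QuantumFieldTheory.PlaquetteLowerBound (reTr continuous_reTr)

namespace Summit.Ventures.YMGap.ZeroCouplingSlope

variable {d N : ℕ} {G : Type*} [Group G] [TopologicalSpace G] [IsTopologicalGroup G] [CompactSpace G]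
  [MeasurableSpace G] [BorelSpace G] [SecondCountableTopology G] (ρ : G →* Matrix (Fin N) (Fin N) ℂ)

/-- Local notation: the un-tilted kernel measure of `Λ` with boundary condition `η`. -/
local notation3 (prettyPrint := false) "π⟦" Λ ", " η "⟧" =>
  ((Measure.pi fun _ : ↥(Λ : Finset (ZdEdge d)) => haarProbability G).map (glueWith Λ · (η : LGConfig d G)))

/-! ## 1. Resampling a link of `p` that a continuous factor ignores -/

/-- ★ **General decoupling under the `β = 0` kernel of the four links of `p`**: if a continuous `Ψ`, read through the gluing, ignores
the link `e` of `p`, then `∫ Φ(U_p) Ψ dπ = (∫ Φ dHaar) ∫ Ψ dπ` for every boundary condition (gen 11's `integral_comp_plaquette_mul_eq`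
after transfer to `dg_∞`). [folklore] -/
theorem integral_comp_holonomy_mul_pi_glueWith_of_update {Φ : G → ℝ} (hΦ : Continuous Φ) (p : ZdPlaquette d) {e : ZdEdge d}
    (he : e ∈ plaquetteEdges p) (η : LGConfig d G) {Ψ : LGConfig d G → ℝ} (hΨc : Continuous Ψ)
    (hΨe : ∀ (U : LGConfig d G) (g : G), Ψ (glueWith (plaquetteEdges p) ((plaquetteEdges p).restrict (Function.update U e g)) η) =
      Ψ (glueWith (plaquetteEdges p) ((plaquetteEdges p).restrict U) η)) :
    ∫ U, Φ (plaquetteHolonomyZd U p.1 p.2.1.1 p.2.1.2) * Ψ U ∂π⟦plaquetteEdges p, η⟧ =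
      (∫ g, Φ g ∂haarProbability G) * ∫ U, Ψ U ∂π⟦plaquetteEdges p, η⟧ := by
  have hhol : Continuous fun U : LGConfig d G => Φ (plaquetteHolonomyZd U p.1 p.2.1.1 p.2.1.2) :=
    hΦ.comp (AreaLaw.continuous_plaquette p.1 p.2.1.1 p.2.1.2)
  have hm : Measurable fun U : LGConfig d G => Φ (plaquetteHolonomyZd U p.1 p.2.1.1 p.2.1.2) * Ψ U :=
    (hhol.mul hΨc).measurable
  rw [integral_pi_glueWith_eq_integral_zdHaar (plaquetteEdges p) η hm,
    integral_pi_glueWith_eq_integral_zdHaar (plaquetteEdges p) η hΨc.measurable]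
  have h : ∀ U : LGConfig d G, plaquetteHolonomyZd (glueWith (plaquetteEdges p) ((plaquetteEdges p).restrict U) η)
      p.1 p.2.1.1 p.2.1.2 = plaquetteHolonomyZd U p.1 p.2.1.1 p.2.1.2 := fun U =>
    apply_glueWith_restrict_of_isCylinder (isCylinder_plaquetteHolonomyZd (G := G) p) U η
  simp_rw [h]
  exact ZeroCouplingMoments.integral_comp_plaquette_mul_eq hΦ p he (hΨc.comp (continuous_glueWith_restrict _ η)) hΨe

omit [TopologicalSpace G] [IsTopologicalGroup G] [CompactSpace G] [MeasurableSpace G] [BorelSpace G] [SecondCountableTopology G] in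
/-- A plaquette observable of `q`, read through the gluing of the links of `p`, ignores every link of `p` outside `q`. [folklore] -/
theorem plaquetteObs_glueWith_restrict_update (p q : ZdPlaquette d) {e : ZdEdge d} (heq : e ∉ plaquetteEdges q) (η U : LGConfig d G)
    (g : G) : plaquetteObs ρ q.1 q.2.1.1 q.2.1.2 (glueWith (plaquetteEdges p) ((plaquetteEdges p).restrict (Function.update U e g)) η) =
      plaquetteObs ρ q.1 q.2.1.1 q.2.1.2 (glueWith (plaquetteEdges p) ((plaquetteEdges p).restrict U) η) := by
  refine isCylinder_plaquetteObs ρ q fun e' he' => ?_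
  have hne : e' ≠ e := by rintro rfl; exact heq (Finset.mem_coe.1 he')
  by_cases he'Λ : e' ∈ plaquetteEdges p
  · rw [glueWith_apply_mem _ _ _ he'Λ, glueWith_apply_mem _ _ _ he'Λ]
    show Function.update U e g e' = U e'
    rw [Function.update_of_ne hne]
  · rw [glueWith_apply_not_mem _ _ _ he'Λ, glueWith_apply_not_mem _ _ _ he'Λ]

/-! ## 2. The kernel estimate: `Φ_η(β) − ⟨φ⟩₁(β) = O(β⁴)` for every boundary condition -/

/-- **Ratio algebra**: `|A/Z − a/z| ≤ e^{x} R` when `|A z − a Z| ≤ z R`, `Z ≥ e^{−x}`, `Z, z > 0`. [folklore] -/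
theorem abs_div_sub_div_le_of_abs_sub_le {A Z a z R x : ℝ} (hZ : 0 < Z) (hz : 0 < z) (hAz : |A * z - a * Z| ≤ z * R)
    (hZlb : Real.exp (-x) ≤ Z) (hR : 0 ≤ R) : |A / Z - a / z| ≤ Real.exp x * R := by
  rw [div_sub_div _ _ hZ.ne' hz.ne', abs_div, abs_of_pos (mul_pos hZ hz), mul_comm Z a,
    div_le_iff₀ (mul_pos hZ hz)]
  have h1 : (1 : ℝ) ≤ Real.exp x * Z := by
    calc (1 : ℝ) = Real.exp x * Real.exp (-x) := by rw [← Real.exp_add]; simp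
      _ ≤ Real.exp x * Z := mul_le_mul_of_nonneg_left hZlb (Real.exp_pos _).le
  calc |A * z - a * Z| ≤ z * R := hAz
    _ = (z * R) * 1 := (mul_one _).symm
    _ ≤ (z * R) * (Real.exp x * Z) := mul_le_mul_of_nonneg_left h1 (mul_nonneg hz.le hR)
    _ = Real.exp x * R * (Z * z) := by ring

/-- **The `|β| ≤ 1` book-keeping**: with `t = e^{|β| b} − 1 ≤ |β| b e^{b}`, the kernel bound collapses to `K₁ β⁴`. [folklore] -/
theorem kernelBound_le_of_abs_le_one {β b C : ℝ} (k : ℝ) (n : ℕ) (hβ : |β| ≤ 1) (hb : 0 ≤ b) (hC : 0 ≤ C) (hk : 0 ≤ k) :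
    Real.exp (|β| * (b * k)) * (2 ^ n * (2 * C * Real.exp (|β| * b) *
        ((Real.exp (|β| * b) - 1) ^ 4 * (1 + (Real.exp (|β| * b) - 1)) ^ n))) ≤
      2 ^ (n + 1) * C * (Real.exp b * Real.exp (b * k)) * ((b * Real.exp b) ^ 4 * (1 + b * Real.exp b) ^ n) * β ^ 4 := by
  set t : ℝ := Real.exp (|β| * b) - 1 with ht
  have ht0 : 0 ≤ t := by simp only [ht]; linarith [Real.one_le_exp (mul_nonneg (abs_nonneg β) hb)]
  have hexp1 : Real.exp (|β| * b) ≤ Real.exp b := Real.exp_le_exp.2 (mul_le_of_le_one_left hb hβ)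
  have hexp2 : Real.exp (|β| * (b * k)) ≤ Real.exp (b * k) := Real.exp_le_exp.2 (mul_le_of_le_one_left (mul_nonneg hb hk) hβ)
  have hbe : 0 ≤ b * Real.exp b := mul_nonneg hb (Real.exp_pos b).le
  have ht_le : t ≤ |β| * (b * Real.exp b) := by
    simp only [ht]
    calc Real.exp (|β| * b) - 1 ≤ (|β| * b) * Real.exp (|β| * b) := AreaLaw.exp_sub_one_le_mul_exp _
      _ ≤ (|β| * b) * Real.exp b := mul_le_mul_of_nonneg_left hexp1 (mul_nonneg (abs_nonneg _) hb)
      _ = |β| * (b * Real.exp b) := by ring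
  have ht_le' : t ≤ b * Real.exp b := ht_le.trans (mul_le_of_le_one_left hbe hβ)
  have hQ0 : 0 ≤ t ^ 4 * (1 + t) ^ n := mul_nonneg (pow_nonneg ht0 4) (pow_nonneg (by linarith) n)
  have w1 : Real.exp (|β| * b) * Real.exp (|β| * (b * k)) ≤ Real.exp b * Real.exp (b * k) :=
    mul_le_mul hexp1 hexp2 (Real.exp_pos _).le (Real.exp_pos _).le
  have w2 : t ^ 4 * (1 + t) ^ n ≤ (|β| * (b * Real.exp b)) ^ 4 * (1 + b * Real.exp b) ^ n :=
    mul_le_mul (pow_le_pow_left₀ ht0 ht_le 4) (pow_le_pow_left₀ (by linarith) (by linarith) n) (pow_nonneg (by linarith) n)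
      (pow_nonneg (mul_nonneg (abs_nonneg _) hbe) 4)
  have h2C : 0 ≤ (2 : ℝ) ^ (n + 1) * C := mul_nonneg (pow_nonneg (by norm_num) _) hC
  calc Real.exp (|β| * (b * k)) * (2 ^ n * (2 * C * Real.exp (|β| * b) * (t ^ 4 * (1 + t) ^ n)))
      = (2 : ℝ) ^ (n + 1) * C * (Real.exp (|β| * b) * Real.exp (|β| * (b * k))) * (t ^ 4 * (1 + t) ^ n) := by ring
    _ ≤ (2 : ℝ) ^ (n + 1) * C * (Real.exp b * Real.exp (b * k)) * ((|β| * (b * Real.exp b)) ^ 4 * (1 + b * Real.exp b) ^ n) :=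
        mul_le_mul (mul_le_mul_of_nonneg_left w1 h2C) w2 hQ0
          (mul_nonneg h2C (mul_nonneg (Real.exp_pos _).le (Real.exp_pos _).le))
    _ = 2 ^ (n + 1) * C * (Real.exp b * Real.exp (b * k)) * ((b * Real.exp b) ^ 4 * (1 + b * Real.exp b) ^ n) * β ^ 4 := by
        rw [mul_pow, show |β| ^ 4 = β ^ 4 from Even.pow_abs (by decide) β]; ring

/-- ★ **Exact decoupling of the small terms.** For `p ∉ S` with `|S| ≤ 3` some link of `p` lies in no plaquette of `S`
(gen 11's `exists_mem_plaquetteEdges_forall_not_mem`); resampling it under the kernel makes `U_p` Haar distributed independently of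
`Ψ_S = Π_{q∈S} (e^{−β s_q} − 1)`, for EVERY boundary condition, so `z · E_η[φ(U_p) e^{−βs(U_p)} Ψ_S] − a · E_η[e^{−βs(U_p)} Ψ_S] = 0`
(`a, z` the one-plaquette integrals). [folklore] -/
theorem term_sub_term_eq_zero_of_card_le_three (hρ : Continuous ρ) {φ : G → ℝ} (hφ : Continuous φ) (p : ZdPlaquette d)
    (η : LGConfig d G) (β : ℝ) {S : Finset (ZdPlaquette d)} (hpS : p ∉ S) (hsmall : S.card ≤ 3) :
    (∫ U, (φ (plaquetteHolonomyZd U p.1 p.2.1.1 p.2.1.2) *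
          Real.exp (-β * ((N : ℝ) - reTr ρ (plaquetteHolonomyZd U p.1 p.2.1.1 p.2.1.2)))) *
          ∏ q ∈ S, (Real.exp (-β * ((N : ℝ) - plaquetteObs ρ q.1 q.2.1.1 q.2.1.2 U)) - 1) ∂π⟦plaquetteEdges p, η⟧) *
        (∫ g, Real.exp (-β * ((N : ℝ) - reTr ρ g)) ∂haarProbability G) -
      (∫ g, φ g * Real.exp (-β * ((N : ℝ) - reTr ρ g)) ∂haarProbability G) *
        ∫ U, Real.exp (-β * ((N : ℝ) - reTr ρ (plaquetteHolonomyZd U p.1 p.2.1.1 p.2.1.2))) *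
          ∏ q ∈ S, (Real.exp (-β * ((N : ℝ) - plaquetteObs ρ q.1 q.2.1.1 q.2.1.2 U)) - 1) ∂π⟦plaquetteEdges p, η⟧ = 0 := by
  classical
  set Φβ : G → ℝ := fun g => φ g * Real.exp (-β * ((N : ℝ) - reTr ρ g)) with hΦβ
  set Φ1 : G → ℝ := fun g => Real.exp (-β * ((N : ℝ) - reTr ρ g)) with hΦ1
  set ΨS : LGConfig d G → ℝ := fun U => ∏ q ∈ S, (Real.exp (-β * ((N : ℝ) - plaquetteObs ρ q.1 q.2.1.1 q.2.1.2 U)) - 1) with hΨS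
  have hΦβ_c : Continuous Φβ := hφ.mul (continuous_const.mul (continuous_const.sub (continuous_reTr ρ hρ))).rexp
  have hΦ1_c : Continuous Φ1 := (continuous_const.mul (continuous_const.sub (continuous_reTr ρ hρ))).rexp
  have hΨ_c : Continuous ΨS := by
    simp only [hΨS]
    exact continuous_finsetProd _ fun q _ =>
      ((continuous_const.mul (continuous_const.sub (continuous_plaquetteObs ρ hρ _ _ _))).rexp).sub continuous_const
  obtain ⟨e, hep, heS⟩ := ZeroCouplingMoments.exists_mem_plaquetteEdges_forall_not_mem p hpS hsmall
  have hΨe : ∀ (U : LGConfig d G) (g : G),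
      ΨS (glueWith (plaquetteEdges p) ((plaquetteEdges p).restrict (Function.update U e g)) η) =
        ΨS (glueWith (plaquetteEdges p) ((plaquetteEdges p).restrict U) η) := fun U g => by
    simp only [hΨS]
    exact Finset.prod_congr rfl fun q hq => by rw [plaquetteObs_glueWith_restrict_update ρ p q (heS q hq) η U g]
  have h1 := integral_comp_holonomy_mul_pi_glueWith_of_update hΦβ_c p hep η hΨ_c hΨe
  have h2 := integral_comp_holonomy_mul_pi_glueWith_of_update hΦ1_c p hep η hΨ_c hΨe
  show (∫ U, Φβ (plaquetteHolonomyZd U p.1 p.2.1.1 p.2.1.2) * ΨS U ∂π⟦plaquetteEdges p, η⟧) *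
      (∫ g, Real.exp (-β * ((N : ℝ) - reTr ρ g)) ∂haarProbability G) -
    (∫ g, φ g * Real.exp (-β * ((N : ℝ) - reTr ρ g)) ∂haarProbability G) *
      ∫ U, Φ1 (plaquetteHolonomyZd U p.1 p.2.1.1 p.2.1.2) * ΨS U ∂π⟦plaquetteEdges p, η⟧ = 0
  rw [h1, h2]; simp only [hΦβ, hΦ1]; ring

omit [SecondCountableTopology G] in
/-- **The crude termwise bound**, every finite set `S` of plaquettes: `|z · E_η[φ e^{−βs}(U_p) Ψ_S] − a · E_η[e^{−βs}(U_p) Ψ_S]| ≤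
2 C z e^{|β|b} t^{|S|}` (`b = N + M`, `t = e^{|β| b} − 1`; each factor of `Ψ_S` is at most `t` in absolute value). [folklore] -/
theorem abs_term_sub_term_le_pow (hρ : Continuous ρ) {M : ℝ} (hM : ∀ g : G, |(ρ g).trace.re| ≤ M) {φ : G → ℝ}
    {C : ℝ} (hC : ∀ g, |φ g| ≤ C) (p : ZdPlaquette d) (η : LGConfig d G) (β : ℝ) (S : Finset (ZdPlaquette d)) :
    |(∫ U, (φ (plaquetteHolonomyZd U p.1 p.2.1.1 p.2.1.2) *
          Real.exp (-β * ((N : ℝ) - reTr ρ (plaquetteHolonomyZd U p.1 p.2.1.1 p.2.1.2)))) *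
          ∏ q ∈ S, (Real.exp (-β * ((N : ℝ) - plaquetteObs ρ q.1 q.2.1.1 q.2.1.2 U)) - 1) ∂π⟦plaquetteEdges p, η⟧) *
        (∫ g, Real.exp (-β * ((N : ℝ) - reTr ρ g)) ∂haarProbability G) -
      (∫ g, φ g * Real.exp (-β * ((N : ℝ) - reTr ρ g)) ∂haarProbability G) *
        ∫ U, Real.exp (-β * ((N : ℝ) - reTr ρ (plaquetteHolonomyZd U p.1 p.2.1.1 p.2.1.2))) *
          ∏ q ∈ S, (Real.exp (-β * ((N : ℝ) - plaquetteObs ρ q.1 q.2.1.1 q.2.1.2 U)) - 1) ∂π⟦plaquetteEdges p, η⟧| ≤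
      2 * C * (∫ g, Real.exp (-β * ((N : ℝ) - reTr ρ g)) ∂haarProbability G) * Real.exp (|β| * ((N : ℝ) + M)) *
        (Real.exp (|β| * ((N : ℝ) + M)) - 1) ^ S.card := by
  classical
  set b : ℝ := (N : ℝ) + M with hb
  set t : ℝ := Real.exp (|β| * b) - 1 with ht
  set z : ℝ := ∫ g, Real.exp (-β * ((N : ℝ) - reTr ρ g)) ∂haarProbability G with hz
  set a : ℝ := ∫ g, φ g * Real.exp (-β * ((N : ℝ) - reTr ρ g)) ∂haarProbability G with ha
  set Φβ : G → ℝ := fun g => φ g * Real.exp (-β * ((N : ℝ) - reTr ρ g)) with hΦβ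
  set Φ1 : G → ℝ := fun g => Real.exp (-β * ((N : ℝ) - reTr ρ g)) with hΦ1
  set ΨS : LGConfig d G → ℝ := fun U => ∏ q ∈ S, (Real.exp (-β * ((N : ℝ) - plaquetteObs ρ q.1 q.2.1.1 q.2.1.2 U)) - 1) with hΨS
  haveI hπP : IsProbabilityMeasure π⟦plaquetteEdges p, η⟧ := isProbabilityMeasure_pi_glueWith _ η
  have hM0 : 0 ≤ M := (abs_nonneg _).trans (hM 1)
  have hb0 : 0 ≤ b := by simp only [hb]; exact add_nonneg (Nat.cast_nonneg N) hM0
  have hC0 : 0 ≤ C := (abs_nonneg _).trans (hC 1)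
  have hs_b : ∀ g, |(N : ℝ) - reTr ρ g| ≤ b := fun g => by
    have h1 := hM g; simp only [hb, reTr]; rw [abs_le] at h1 ⊢
    have hN : (0 : ℝ) ≤ N := Nat.cast_nonneg N
    constructor <;> [linarith [h1.2]; linarith [h1.1]]
  have hexpb : ∀ x : ℝ, |x| ≤ b → |Real.exp (-β * x)| ≤ Real.exp (|β| * b) := fun x hx => by
    rw [Real.abs_exp, Real.exp_le_exp]
    calc -β * x ≤ |-β * x| := le_abs_self _
      _ = |β| * |x| := by rw [abs_mul, abs_neg]
      _ ≤ |β| * b := mul_le_mul_of_nonneg_left hx (abs_nonneg _)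
  have hΦ1_c : Continuous Φ1 := (continuous_const.mul (continuous_const.sub (continuous_reTr ρ hρ))).rexp
  have hΦβ_b : ∀ g, |Φβ g| ≤ C * Real.exp (|β| * b) := fun g => by
    simp only [hΦβ]; rw [abs_mul]; exact mul_le_mul (hC g) (hexpb _ (hs_b g)) (abs_nonneg _) hC0
  have hΦ1_b : ∀ g, |Φ1 g| ≤ Real.exp (|β| * b) := fun g => hexpb _ (hs_b g)
  have hz_pos : 0 < z := by
    simp only [hz]; exact integral_exp_pos (integrable_of_bound hΦ1_c.aestronglyMeasurable hΦ1_b)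
  have haz : |a| ≤ C * z := by
    simp only [ha, hz]
    calc |∫ g, φ g * Real.exp (-β * ((N : ℝ) - reTr ρ g)) ∂haarProbability G|
        ≤ ∫ g, |φ g * Real.exp (-β * ((N : ℝ) - reTr ρ g))| ∂haarProbability G := abs_integral_le_integral_abs
      _ ≤ ∫ g, C * Real.exp (-β * ((N : ℝ) - reTr ρ g)) ∂haarProbability G := by
          refine integral_mono_of_nonneg (ae_of_all _ fun g => abs_nonneg _)
            ((integrable_of_bound hΦ1_c.aestronglyMeasurable hΦ1_b).const_mul C) (ae_of_all _ fun g => ?_)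
          dsimp only
          rw [abs_mul, Real.abs_exp]
          exact mul_le_mul_of_nonneg_right (hC g) (Real.exp_pos _).le
      _ = C * ∫ g, Real.exp (-β * ((N : ℝ) - reTr ρ g)) ∂haarProbability G := integral_const_mul _ _
  have abs_exp_sub_one_le : ∀ x : ℝ, |Real.exp x - 1| ≤ Real.exp |x| - 1 := fun x => by
    rcases le_or_gt 0 x with hx | hx
    · rw [abs_of_nonneg hx, abs_of_nonneg (by simpa using Real.one_le_exp hx)]
    · rw [abs_of_nonpos hx.le, abs_of_nonpos (sub_nonpos.2 (Real.exp_le_one_iff.2 hx.le))]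
      have h1 := Real.add_one_le_exp (-x)
      have h2 := Real.add_one_le_exp x
      linarith
  have hΨ_b : ∀ U, |ΨS U| ≤ t ^ S.card := fun U => by
    simp only [hΨS]; rw [Finset.abs_prod]
    calc ∏ q ∈ S, |Real.exp (-β * ((N : ℝ) - plaquetteObs ρ q.1 q.2.1.1 q.2.1.2 U)) - 1| ≤ ∏ _q ∈ S, t :=
          Finset.prod_le_prod (fun q _ => abs_nonneg _) fun q _ => by
            refine (abs_exp_sub_one_le _).trans ?_
            simp only [ht]
            gcongr
            calc |-β * ((N : ℝ) - plaquetteObs ρ q.1 q.2.1.1 q.2.1.2 U)| = |β| * |(N : ℝ) - plaquetteObs ρ q.1 q.2.1.1 q.2.1.2 U| := by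
                  rw [abs_mul, abs_neg]
              _ ≤ |β| * b := mul_le_mul_of_nonneg_left (hs_b _) (abs_nonneg _)
      _ = t ^ S.card := Finset.prod_const t
  show |(∫ U, Φβ (plaquetteHolonomyZd U p.1 p.2.1.1 p.2.1.2) * ΨS U ∂π⟦plaquetteEdges p, η⟧) * z -
      a * ∫ U, Φ1 (plaquetteHolonomyZd U p.1 p.2.1.1 p.2.1.2) * ΨS U ∂π⟦plaquetteEdges p, η⟧| ≤
    2 * C * z * Real.exp (|β| * b) * t ^ S.card
  have e1 : |∫ U, Φβ (plaquetteHolonomyZd U p.1 p.2.1.1 p.2.1.2) * ΨS U ∂π⟦plaquetteEdges p, η⟧| ≤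
      C * Real.exp (|β| * b) * t ^ S.card := by
    have h := norm_integral_le_of_norm_le_const (μ := π⟦plaquetteEdges p, η⟧)
      (f := fun U => Φβ (plaquetteHolonomyZd U p.1 p.2.1.1 p.2.1.2) * ΨS U) (C := C * Real.exp (|β| * b) * t ^ S.card)
      (ae_of_all _ fun U => by
        rw [Real.norm_eq_abs, abs_mul]
        exact mul_le_mul (hΦβ_b _) (hΨ_b U) (abs_nonneg _) (mul_nonneg hC0 (Real.exp_pos _).le))
    rw [probReal_univ, mul_one] at h; simpa only [Real.norm_eq_abs] using h
  have e2 : |∫ U, Φ1 (plaquetteHolonomyZd U p.1 p.2.1.1 p.2.1.2) * ΨS U ∂π⟦plaquetteEdges p, η⟧| ≤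
      Real.exp (|β| * b) * t ^ S.card := by
    have h := norm_integral_le_of_norm_le_const (μ := π⟦plaquetteEdges p, η⟧)
      (f := fun U => Φ1 (plaquetteHolonomyZd U p.1 p.2.1.1 p.2.1.2) * ΨS U) (C := Real.exp (|β| * b) * t ^ S.card)
      (ae_of_all _ fun U => by
        rw [Real.norm_eq_abs, abs_mul]
        exact mul_le_mul (hΦ1_b _) (hΨ_b U) (abs_nonneg _) (Real.exp_pos _).le)
    rw [probReal_univ, mul_one] at h; simpa only [Real.norm_eq_abs] using h
  generalize (∫ U, Φβ (plaquetteHolonomyZd U p.1 p.2.1.1 p.2.1.2) * ΨS U ∂π⟦plaquetteEdges p, η⟧) = I₁ at e1 ⊢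
  generalize (∫ U, Φ1 (plaquetteHolonomyZd U p.1 p.2.1.1 p.2.1.2) * ΨS U ∂π⟦plaquetteEdges p, η⟧) = I₂ at e2 ⊢
  have s1 : |I₁ * z - a * I₂| ≤ z * |I₁| + |a| * |I₂| := by
    calc _ ≤ |I₁ * z| + |a * I₂| := abs_sub _ _
      _ = z * |I₁| + |a| * |I₂| := by rw [abs_mul, abs_mul, abs_of_pos hz_pos, mul_comm |I₁| z]
  have s2 : z * |I₁| ≤ z * (C * Real.exp (|β| * b) * t ^ S.card) := mul_le_mul_of_nonneg_left e1 hz_pos.le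
  have s3 : |a| * |I₂| ≤ (C * z) * (Real.exp (|β| * b) * t ^ S.card) :=
    mul_le_mul haz e2 (abs_nonneg _) (mul_nonneg hC0 hz_pos.le)
  have s4 : z * (C * Real.exp (|β| * b) * t ^ S.card) + (C * z) * (Real.exp (|β| * b) * t ^ S.card) =
      2 * C * z * Real.exp (|β| * b) * t ^ S.card := by ring
  linarith

/-- ★ **The termwise estimate.** For `S ⊆ P(edges p) ∖ {p}` write `Ψ_S = Π_{q∈S} (e^{−β s_q} − 1)`: if `|S| ≤ 3` the numerator and
denominator terms decouple EXACTLY (a private link of `p`); in all cases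
`|z · E_η[φ(U_p) e^{−βs(U_p)} Ψ_S] − a · E_η[e^{−βs(U_p)} Ψ_S]| ≤ 2 C z e^{|β|b} t⁴ (1 + t)ⁿ` (`a, z` the one-plaquette integrals,
`b = N + M`, `t = e^{|β| b} − 1`, `n = #P(edges p) − 1`). [folklore] -/
theorem abs_term_sub_term_le (hρ : Continuous ρ) {M : ℝ} (hM : ∀ g : G, |(ρ g).trace.re| ≤ M) {φ : G → ℝ}
    (hφ : Continuous φ) {C : ℝ} (hC : ∀ g, |φ g| ≤ C) (p : ZdPlaquette d) (η : LGConfig d G) (β : ℝ)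
    {S : Finset (ZdPlaquette d)} (hS : S ⊆ (plaquettesTouching (plaquetteEdges p)).erase p) :
    |(∫ U, (φ (plaquetteHolonomyZd U p.1 p.2.1.1 p.2.1.2) *
          Real.exp (-β * ((N : ℝ) - reTr ρ (plaquetteHolonomyZd U p.1 p.2.1.1 p.2.1.2)))) *
          ∏ q ∈ S, (Real.exp (-β * ((N : ℝ) - plaquetteObs ρ q.1 q.2.1.1 q.2.1.2 U)) - 1) ∂π⟦plaquetteEdges p, η⟧) *
        (∫ g, Real.exp (-β * ((N : ℝ) - reTr ρ g)) ∂haarProbability G) -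
      (∫ g, φ g * Real.exp (-β * ((N : ℝ) - reTr ρ g)) ∂haarProbability G) *
        ∫ U, Real.exp (-β * ((N : ℝ) - reTr ρ (plaquetteHolonomyZd U p.1 p.2.1.1 p.2.1.2))) *
          ∏ q ∈ S, (Real.exp (-β * ((N : ℝ) - plaquetteObs ρ q.1 q.2.1.1 q.2.1.2 U)) - 1) ∂π⟦plaquetteEdges p, η⟧| ≤
      2 * C * (∫ g, Real.exp (-β * ((N : ℝ) - reTr ρ g)) ∂haarProbability G) * Real.exp (|β| * ((N : ℝ) + M)) *
        ((Real.exp (|β| * ((N : ℝ) + M)) - 1) ^ 4 *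
          (1 + (Real.exp (|β| * ((N : ℝ) + M)) - 1)) ^ ((plaquettesTouching (plaquetteEdges p)).card - 1)) := by
  classical
  have hp : p ∈ plaquettesTouching (plaquetteEdges p) := mem_plaquettesTouching_plaquetteEdges p
  set n : ℕ := (plaquettesTouching (plaquetteEdges p)).card - 1 with hn
  have hnT : ((plaquettesTouching (plaquetteEdges p)).erase p).card = n := by rw [Finset.card_erase_of_mem hp]
  set t : ℝ := Real.exp (|β| * ((N : ℝ) + M)) - 1 with ht
  have hM0 : 0 ≤ M := (abs_nonneg _).trans (hM 1)
  have hC0 : 0 ≤ C := (abs_nonneg _).trans (hC 1)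
  have ht0 : 0 ≤ t := by
    simp only [ht]; linarith [Real.one_le_exp (mul_nonneg (abs_nonneg β) (add_nonneg (Nat.cast_nonneg N) hM0))]
  have hz0 : 0 ≤ ∫ g, Real.exp (-β * ((N : ℝ) - reTr ρ g)) ∂haarProbability G := integral_nonneg fun g => (Real.exp_pos _).le
  have h2Cze : 0 ≤ 2 * C * (∫ g, Real.exp (-β * ((N : ℝ) - reTr ρ g)) ∂haarProbability G) * Real.exp (|β| * ((N : ℝ) + M)) :=
    mul_nonneg (mul_nonneg (mul_nonneg (by norm_num) hC0) hz0) (Real.exp_pos _).le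
  rcases le_or_gt S.card 3 with hsmall | hlarge
  · have hpS : p ∉ S := fun h => Finset.notMem_erase p _ (hS h)
    rw [term_sub_term_eq_zero_of_card_le_three ρ hρ hφ p η β hpS hsmall, abs_zero]
    exact mul_nonneg h2Cze (mul_nonneg (pow_nonneg ht0 4) (pow_nonneg (by linarith) n))
  · have hpow : t ^ S.card ≤ t ^ 4 * (1 + t) ^ n := by
      have hSn : S.card ≤ n := by rw [← hnT]; exact Finset.card_le_card hS
      obtain ⟨m, hm⟩ : ∃ m, S.card = 4 + m := ⟨S.card - 4, by omega⟩
      have hmn : m ≤ n := by omega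
      rw [hm, pow_add]
      exact mul_le_mul_of_nonneg_left ((pow_le_pow_left₀ ht0 (by linarith) m).trans
        (pow_le_pow_right₀ (by linarith) hmn)) (pow_nonneg ht0 4)
    exact (abs_term_sub_term_le_pow ρ hρ hM hC p η β S).trans (mul_le_mul_of_nonneg_left hpow h2Cze)

end Summit.Ventures.YMGap.ZeroCouplingSlope
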